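import Literature.NumberTheory.ComplexMultiplication.CommonQuarticCMSubfieldBiquadraticLattice
import Literature.AlgebraicGeometry.ComplexMultiplication.ReflexFieldsMeetRealCMHodge
import HarnessLib

/-!
# Two CM types defined over CM biquadratic fields `F(α₀, β₀)`, `F(α₁, β₁)` over one real field `F`:
# additivity by FOUR RATIOS, and the Hodge conjecture on every `A₀^a × A₁^b`

COR-CM (cell `pub-hodgecm2`, binder seat `b16` gen 50, count-neutral claim CM44-COMMONQUARTIC, file F2; theorems only,
no definition, no named fact, no `sorry`).  NEW as stated, hence under `Summits/`.  HONEST FRAMING: the Hodge conjecture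
is obtained for NAMED products of CM abelian varieties from the tree's `ReflexFieldsMeetRealCMHodge`; `HC_CM` is neither
used nor asserted.

SETTING.  Two slots `i₀ ≠ i₁` (`I = {i₀, i₁}`), a subfield `F ⊂ ℝ` of `ℂ` of finite degree, and for `k = 0, 1` anti-real
numbers `α_k, β_k` (`ᾱ = −α`) with `α_k², β_k² ∈ F`, `α_k β_k ∉ F`, such that the type `Φ_{i_k}` is DEFINED OVER
`E_k = F(α_k, β_k)`: every automorphism of `ℂ` fixing `F` pointwise and fixing `α_k`, `β_k` stabilises `Φ_{i_k}`.  (For a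
one-unsplit-pair type of an octic CM field over a quartic CM subfield `k = k⁺(a)`: `F = z(k⁺)`, `α = z₁(a)`,
`β = x₂(b)` with `b` an anti-real element of the second quartic CM subfield — files F3/F4 of the claim.)

RESULT (F1's lattice engine `CMBiquad.conj_apply_eq_of_mem_of_mem` + the tree's real-intersection criterion): if none of
the FOUR RATIOS `α₀/α₁, α₀/β₁, β₀/α₁, β₀/β₁` lies in `F`, then `E₀ ∩ E₁ ⊂ ℝ`, so

* `isNondegenerateFamily_iff_forall_of_ratios` — the pair is nondegenerate iff both members are;
  `cmFamilyRank_add_card_eq_of_ratios` — rank additivity;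
* **`hodgeConjectureFor_prod_of_ratios`**, `not_exists_exceptional_prod_of_ratios` — for nondegenerate members the Hodge
  conjecture and `B• = D•` hold on every `⨁_{j<N} A_{π j}`, UNCONDITIONALLY.

A ratio in `F` means a coincidence `F(α₀) = F(α₁)` etc. of CM quadratic subfields of the two reflex fields; in the
`(4,4)` cell these coincidences are exactly the «common unsplit place» configurations (file F4).

## References

* [Gordon1999HodgeAVSurvey] B. B. Gordon, *A survey of the Hodge conjecture for abelian varieties*, §3 Theorem, 7.5–7.7,
  10.10.
* [Shimura1998] G. Shimura, *Abelian Varieties with Complex Multiplication and Modular Functions*, §8.3, §8.4 (2)(C).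
* [Lang2002] S. Lang, *Algebra*, VI §1.

Provenance: Literature home (namespace `Literature.AlgebraicGeometry.ComplexMultiplication.CommonQuarticCMSubfieldReflexCoincidences`) of the Summits-side `CorCM/CommonQuarticCMSubfieldReflexCoincidences` (cell `pub-hodgecm2`, COR-CM; all its imports are `Literature/`, Mathlib and the already re-homed `CommonQuarticCMSubfieldBiquadraticLattice`, `ReflexFieldsMeetRealCMHodge`), which `Literature/` may not import; theorems only, no named fact, no definition. Nothing here bears on `HC_CM`. Lane `lit-hodgefound` (Layer A3: CM types, their Kubota ranks and Galois combinatorics), seat p20.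
-/

set_option autoImplicit false

noncomputable section

open scoped ComplexConjugate
open _root_.CategoryTheory _root_.CategoryTheory.Limits NumberField Module

namespace Literature.AlgebraicGeometry.ComplexMultiplication.CommonQuarticCMSubfieldReflexCoincidences

open Literature.NumberTheory.ComplexMultiplication.CMBiquad Literature.AlgebraicGeometry.ComplexMultiplication.ReflexFieldsMeetRealCMHodge Literature.AlgebraicGeometry.ComplexMultiplication.ReflexStabilizersCMHodge Literature.NumberTheory.ComplexMultiplication Literature.AlgebraicGeometry.HodgeTheory Literature.AlgebraicGeometry.Pohlmann1968

open Literature.NumberTheory.ComplexMultiplication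
open Literature.AlgebraicGeometry.Motives (AbelianVariety CMType)
open Literature.AlgebraicGeometry.HodgeTheory
open Literature.AlgebraicGeometry.ComplexMultiplication (IsCMTypeRealisation)
open Literature.AlgebraicGeometry.VanGeemen1994 (hodgeClassSpan)
open Literature.AlgebraicGeometry.Pohlmann1968
open Literature.Barriers.HodgeConjecture (divisorClassesSpan)

variable {I : Type} {K : I → Type} [∀ i, Field (K i)] [∀ i, NumberField (K i)] [∀ i, IsCMField (K i)] [Fintype I]
  [DecidableEq I] [Nonempty I] {Φ : ∀ i, CMType (K i)}
variable {F : IntermediateField ℚ ℂ} {α₀ β₀ α₁ β₁ : ℂ}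

/-! ### §1 Automorphisms fixing `E = F ⊔ ℚ⟮α, β⟯` pointwise -/

omit [∀ i, NumberField (K i)] [∀ i, IsCMField (K i)] [Fintype I] [DecidableEq I] [Nonempty I] in
/-- If every `σ ∈ Aut(ℂ)` fixing `F` pointwise and fixing `α, β` stabilises `Φ_i`, then `E = F ⊔ ℚ⟮α, β⟯` is a field of
definition of `Φ_i` in the sense of `ReflexFieldsMeetRealCMHodge`. [cite: Shimura1998, §8.3] -/
theorem forall_smul_mem_iff_of_fix_sup_adjoin {i : I} {α β : ℂ}
    (hdef : ∀ σ : ℂ ≃+* ℂ, (∀ t : ℂ, t ∈ F → σ t = t) → σ α = α → σ β = β →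
      ∀ x : K i →+* ℂ, σ • x ∈ (Φ i).1 ↔ x ∈ (Φ i).1)
    (σ : ℂ ≃+* ℂ) (hσ : ∀ t : ℂ, t ∈ F ⊔ IntermediateField.adjoin ℚ {α, β} → σ t = t) :
    ∀ x : K i →+* ℂ, σ • x ∈ (Φ i).1 ↔ x ∈ (Φ i).1 :=
  hdef σ (fun t ht => hσ t (CMBiquad.le_sup_adjoin (α := α) (β := β) ht)) (hσ α CMBiquad.left_mem_sup_adjoin)
    (hσ β CMBiquad.right_mem_sup_adjoin)

/-! ### §2 Types: additivity by four ratios -/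

section Types

omit [∀ i, NumberField (K i)] [∀ i, IsCMField (K i)] [Fintype I] [DecidableEq I] [Nonempty I] in
/-- **`E₀ ∩ E₁ ⊂ ℝ` by four ratios** — F1's engine in the form consumed below. [cite: Lang2002, VI §1] -/
theorem conj_apply_eq_of_ratios (hF : ∀ t ∈ F, conj t = t) (hα₀ : conj α₀ = -α₀) (hβ₀ : conj β₀ = -β₀)
    (hA₀ : α₀ * α₀ ∈ F) (hB₀ : β₀ * β₀ ∈ F) (hind₀ : α₀ * β₀ ∉ F) (hα₁ : conj α₁ = -α₁) (hβ₁ : conj β₁ = -β₁)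
    (hA₁ : α₁ * α₁ ∈ F) (hB₁ : β₁ * β₁ ∈ F) (hind₁ : α₁ * β₁ ∉ F) (h₁ : ∀ f ∈ F, α₀ ≠ f * α₁)
    (h₂ : ∀ f ∈ F, α₀ ≠ f * β₁) (h₃ : ∀ f ∈ F, β₀ ≠ f * α₁) (h₄ : ∀ f ∈ F, β₀ ≠ f * β₁) :
    ∀ z : ℂ, z ∈ F ⊔ IntermediateField.adjoin ℚ {α₀, β₀} → z ∈ F ⊔ IntermediateField.adjoin ℚ {α₁, β₁} →
      starRingEnd ℂ z = z :=
  CMBiquad.conj_apply_eq_of_mem_of_mem hF hα₀ hβ₀ hA₀ hB₀ hind₀ hα₁ hβ₁ hA₁ hB₁ hind₁ h₁ h₂ h₃ h₄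

/-- **Additivity by four ratios (types).**  `I = {i₀, i₁}`; `F ⊂ ℝ` of finite degree; `Φ_{i₀}` defined over `F(α₀, β₀)`,
`Φ_{i₁}` over `F(α₁, β₁)` (CM biquadratic data over `F`); none of `α₀/α₁, α₀/β₁, β₀/α₁, β₀/β₁` in `F` ⟹ the pair is
nondegenerate iff both members are. [cite: Gordon1999HodgeAVSurvey, §3 Theorem and 7.5–7.7] [cite: Shimura1998, §8.3] -/
theorem isNondegenerateFamily_iff_forall_of_ratios {i₀ i₁ : I} (h01 : i₀ ≠ i₁) (hI : ∀ j, j = i₀ ∨ j = i₁)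
    [FiniteDimensional ℚ F] (hF : ∀ t ∈ F, conj t = t) (hα₀ : conj α₀ = -α₀) (hβ₀ : conj β₀ = -β₀)
    (hA₀ : α₀ * α₀ ∈ F) (hB₀ : β₀ * β₀ ∈ F) (hind₀ : α₀ * β₀ ∉ F) (hα₁ : conj α₁ = -α₁) (hβ₁ : conj β₁ = -β₁)
    (hA₁ : α₁ * α₁ ∈ F) (hB₁ : β₁ * β₁ ∈ F) (hind₁ : α₁ * β₁ ∉ F)
    (hdef₀ : ∀ σ : ℂ ≃+* ℂ, (∀ t : ℂ, t ∈ F → σ t = t) → σ α₀ = α₀ → σ β₀ = β₀ →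
      ∀ x : K i₀ →+* ℂ, σ • x ∈ (Φ i₀).1 ↔ x ∈ (Φ i₀).1)
    (hdef₁ : ∀ σ : ℂ ≃+* ℂ, (∀ t : ℂ, t ∈ F → σ t = t) → σ α₁ = α₁ → σ β₁ = β₁ →
      ∀ y : K i₁ →+* ℂ, σ • y ∈ (Φ i₁).1 ↔ y ∈ (Φ i₁).1)
    (h₁ : ∀ f ∈ F, α₀ ≠ f * α₁) (h₂ : ∀ f ∈ F, α₀ ≠ f * β₁) (h₃ : ∀ f ∈ F, β₀ ≠ f * α₁)
    (h₄ : ∀ f ∈ F, β₀ ≠ f * β₁) :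
    CMAlgebra.IsNondegenerateFamily Φ ↔ ∀ i, IsNondegenerate (Φ i) := by
  haveI := CMBiquad.finiteDimensional_sup_adjoin hA₀ hB₀
  haveI := CMBiquad.finiteDimensional_sup_adjoin hA₁ hB₁
  exact isNondegenerateFamily_iff_forall_of_fixingFields_inf_real h01 hI (F ⊔ IntermediateField.adjoin ℚ {α₀, β₀})
    (F ⊔ IntermediateField.adjoin ℚ {α₁, β₁}) (forall_smul_mem_iff_of_fix_sup_adjoin hdef₀)
    (forall_smul_mem_iff_of_fix_sup_adjoin hdef₁)
    (conj_apply_eq_of_ratios hF hα₀ hβ₀ hA₀ hB₀ hind₀ hα₁ hβ₁ hA₁ hB₁ hind₁ h₁ h₂ h₃ h₄)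

/-- **Rank additivity by four ratios**: `rank(Φ_{i₀}, Φ_{i₁}) + 2 = rank Φ_{i₀} + rank Φ_{i₁} + 1`.
[cite: Gordon1999HodgeAVSurvey, §3 Theorem (1)] -/
theorem cmFamilyRank_add_card_eq_of_ratios {i₀ i₁ : I} (h01 : i₀ ≠ i₁) (hI : ∀ j, j = i₀ ∨ j = i₁)
    [FiniteDimensional ℚ F] (hF : ∀ t ∈ F, conj t = t) (hα₀ : conj α₀ = -α₀) (hβ₀ : conj β₀ = -β₀)
    (hA₀ : α₀ * α₀ ∈ F) (hB₀ : β₀ * β₀ ∈ F) (hind₀ : α₀ * β₀ ∉ F) (hα₁ : conj α₁ = -α₁) (hβ₁ : conj β₁ = -β₁)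
    (hA₁ : α₁ * α₁ ∈ F) (hB₁ : β₁ * β₁ ∈ F) (hind₁ : α₁ * β₁ ∉ F)
    (hdef₀ : ∀ σ : ℂ ≃+* ℂ, (∀ t : ℂ, t ∈ F → σ t = t) → σ α₀ = α₀ → σ β₀ = β₀ →
      ∀ x : K i₀ →+* ℂ, σ • x ∈ (Φ i₀).1 ↔ x ∈ (Φ i₀).1)
    (hdef₁ : ∀ σ : ℂ ≃+* ℂ, (∀ t : ℂ, t ∈ F → σ t = t) → σ α₁ = α₁ → σ β₁ = β₁ →
      ∀ y : K i₁ →+* ℂ, σ • y ∈ (Φ i₁).1 ↔ y ∈ (Φ i₁).1)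
    (h₁ : ∀ f ∈ F, α₀ ≠ f * α₁) (h₂ : ∀ f ∈ F, α₀ ≠ f * β₁) (h₃ : ∀ f ∈ F, β₀ ≠ f * α₁)
    (h₄ : ∀ f ∈ F, β₀ ≠ f * β₁) :
    CMAlgebra.cmFamilyRank Φ + Fintype.card I = (∑ i, cmTypeRank (Φ i)) + 1 := by
  haveI := CMBiquad.finiteDimensional_sup_adjoin hA₀ hB₀
  haveI := CMBiquad.finiteDimensional_sup_adjoin hA₁ hB₁
  exact cmFamilyRank_add_card_eq_of_fixingFields_inf_real h01 hI (F ⊔ IntermediateField.adjoin ℚ {α₀, β₀})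
    (F ⊔ IntermediateField.adjoin ℚ {α₁, β₁}) (forall_smul_mem_iff_of_fix_sup_adjoin hdef₀)
    (forall_smul_mem_iff_of_fix_sup_adjoin hdef₁)
    (conj_apply_eq_of_ratios hF hα₀ hβ₀ hA₀ hB₀ hind₀ hα₁ hβ₁ hA₁ hB₁ hind₁ h₁ h₂ h₃ h₄)

end Types

/-! ### §3 Abelian varieties -/

section Geometry

variable {A : I → AbelianVariety ℂ} {ι : ∀ i, 𝓞 (K i) →+* End (A i)}
  {θ : ∀ i, K i →+* Module.End ℂ (complexBetti (A i).X 1)}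

/-- **The Hodge conjecture on every `A_{i₀}^a × A_{i₁}^b` by four ratios.**  For realisations of NONDEGENERATE types
defined over CM biquadratic fields `F(α₀, β₀)`, `F(α₁, β₁)` over one real field `F` with none of the four ratios in `F`:
HC and `B• = D•` on every `⨁_{j<N} A_{π j}` — UNCONDITIONALLY. [cite: Gordon1999HodgeAVSurvey, §3 Theorem and 10.10]
[cite: Shimura1998, §8.3] -/
theorem hodgeConjectureFor_prod_of_ratios {i₀ i₁ : I} (h01 : i₀ ≠ i₁) (hI : ∀ j, j = i₀ ∨ j = i₁)
    [FiniteDimensional ℚ F] (hF : ∀ t ∈ F, conj t = t) (hα₀ : conj α₀ = -α₀) (hβ₀ : conj β₀ = -β₀)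
    (hA₀ : α₀ * α₀ ∈ F) (hB₀ : β₀ * β₀ ∈ F) (hind₀ : α₀ * β₀ ∉ F) (hα₁ : conj α₁ = -α₁) (hβ₁ : conj β₁ = -β₁)
    (hA₁ : α₁ * α₁ ∈ F) (hB₁ : β₁ * β₁ ∈ F) (hind₁ : α₁ * β₁ ∉ F)
    (hdef₀ : ∀ σ : ℂ ≃+* ℂ, (∀ t : ℂ, t ∈ F → σ t = t) → σ α₀ = α₀ → σ β₀ = β₀ →
      ∀ x : K i₀ →+* ℂ, σ • x ∈ (Φ i₀).1 ↔ x ∈ (Φ i₀).1)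
    (hdef₁ : ∀ σ : ℂ ≃+* ℂ, (∀ t : ℂ, t ∈ F → σ t = t) → σ α₁ = α₁ → σ β₁ = β₁ →
      ∀ y : K i₁ →+* ℂ, σ • y ∈ (Φ i₁).1 ↔ y ∈ (Φ i₁).1)
    (h₁ : ∀ f ∈ F, α₀ ≠ f * α₁) (h₂ : ∀ f ∈ F, α₀ ≠ f * β₁) (h₃ : ∀ f ∈ F, β₀ ≠ f * α₁)
    (h₄ : ∀ f ∈ F, β₀ ≠ f * β₁) (hnd : ∀ i, IsNondegenerate (Φ i))
    (hA : ∀ i, IsCMTypeRealisation (Φ i) (A i) (ι i) (θ i)) {N : ℕ} (π : Fin N → I) :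
    HodgeConjectureFor (⨁ fun j : Fin N => A (π j)).dim (⨁ fun j : Fin N => A (π j)).X ∧
      ∀ m : ℕ, hodgeClassSpan (⨁ fun j : Fin N => A (π j)).dim (⨁ fun j : Fin N => A (π j)).X m =
        divisorClassesSpan (⨁ fun j : Fin N => A (π j)).X (⨁ fun j : Fin N => A (π j)).dim m := by
  haveI := CMBiquad.finiteDimensional_sup_adjoin hA₀ hB₀
  haveI := CMBiquad.finiteDimensional_sup_adjoin hA₁ hB₁
  exact hodgeConjectureFor_prod_of_fixingFields_inf_real h01 hI (F ⊔ IntermediateField.adjoin ℚ {α₀, β₀})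
    (F ⊔ IntermediateField.adjoin ℚ {α₁, β₁}) (forall_smul_mem_iff_of_fix_sup_adjoin hdef₀)
    (forall_smul_mem_iff_of_fix_sup_adjoin hdef₁)
    (conj_apply_eq_of_ratios hF hα₀ hβ₀ hA₀ hB₀ hind₀ hα₁ hβ₁ hA₁ hB₁ hind₁ h₁ h₂ h₃ h₄) hnd hA π

/-- **No exceptional Hodge class on any `A_{i₀}^a × A_{i₁}^b`** under the same hypotheses.
[cite: Gordon1999HodgeAVSurvey, 7.5 and 7.6.1] -/
theorem not_exists_exceptional_prod_of_ratios {i₀ i₁ : I} (h01 : i₀ ≠ i₁) (hI : ∀ j, j = i₀ ∨ j = i₁)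
    [FiniteDimensional ℚ F] (hF : ∀ t ∈ F, conj t = t) (hα₀ : conj α₀ = -α₀) (hβ₀ : conj β₀ = -β₀)
    (hA₀ : α₀ * α₀ ∈ F) (hB₀ : β₀ * β₀ ∈ F) (hind₀ : α₀ * β₀ ∉ F) (hα₁ : conj α₁ = -α₁) (hβ₁ : conj β₁ = -β₁)
    (hA₁ : α₁ * α₁ ∈ F) (hB₁ : β₁ * β₁ ∈ F) (hind₁ : α₁ * β₁ ∉ F)
    (hdef₀ : ∀ σ : ℂ ≃+* ℂ, (∀ t : ℂ, t ∈ F → σ t = t) → σ α₀ = α₀ → σ β₀ = β₀ →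
      ∀ x : K i₀ →+* ℂ, σ • x ∈ (Φ i₀).1 ↔ x ∈ (Φ i₀).1)
    (hdef₁ : ∀ σ : ℂ ≃+* ℂ, (∀ t : ℂ, t ∈ F → σ t = t) → σ α₁ = α₁ → σ β₁ = β₁ →
      ∀ y : K i₁ →+* ℂ, σ • y ∈ (Φ i₁).1 ↔ y ∈ (Φ i₁).1)
    (h₁ : ∀ f ∈ F, α₀ ≠ f * α₁) (h₂ : ∀ f ∈ F, α₀ ≠ f * β₁) (h₃ : ∀ f ∈ F, β₀ ≠ f * α₁)
    (h₄ : ∀ f ∈ F, β₀ ≠ f * β₁) (hnd : ∀ i, IsNondegenerate (Φ i))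
    (hA : ∀ i, IsCMTypeRealisation (Φ i) (A i) (ι i) (θ i)) {N : ℕ} (π : Fin N → I) (m : ℕ) :
    ¬∃ c : complexBetti (⨁ fun j : Fin N => A (π j)).X (2 * m), IsRationalClass c ∧
        IsOfHodgeType (⨁ fun j : Fin N => A (π j)).dim (⨁ fun j : Fin N => A (π j)).X (2 * m) m m c ∧
        c ∉ divisorClassesSpan (⨁ fun j : Fin N => A (π j)).X (⨁ fun j : Fin N => A (π j)).dim m := by
  haveI := CMBiquad.finiteDimensional_sup_adjoin hA₀ hB₀
  haveI := CMBiquad.finiteDimensional_sup_adjoin hA₁ hB₁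
  exact not_exists_exceptional_prod_of_fixingFields_inf_real h01 hI (F ⊔ IntermediateField.adjoin ℚ {α₀, β₀})
    (F ⊔ IntermediateField.adjoin ℚ {α₁, β₁}) (forall_smul_mem_iff_of_fix_sup_adjoin hdef₀)
    (forall_smul_mem_iff_of_fix_sup_adjoin hdef₁)
    (conj_apply_eq_of_ratios hF hα₀ hβ₀ hA₀ hB₀ hind₀ hα₁ hβ₁ hA₁ hB₁ hind₁ h₁ h₂ h₃ h₄) hnd hA π m

end Geometry

end Literature.AlgebraicGeometry.ComplexMultiplication.CommonQuarticCMSubfieldReflexCoincidences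

end
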